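import Summits.AnomalousDissipation.AnomalousDissipation.Theorems.SolenoidalFractalHomogenisationLagrangianStepTrimLevel
import Summits.AnomalousDissipation.AnomalousDissipation.Theorems.SolenoidalFractalHomogenisationLagrangianStepTemplateAsymptotics
import HarnessLib

/-!
# K1L_D (stmt-AnomalousDissipation-27980), stub S23″: the LEFTOVER CUT `Lg` and the exponent ledger of the tracked range (S3′ bricks)
# (helper; `--supports … --as helper`)

The assembly of S23″ (`Cruxes/…/Lines/onelevel_S23_split.lean` §5, decomposition of record v9+) tracks the slow modes `|ℓ| ≤ Lg`,
`Lg := ⌊ρ^{1/96}·N(m+1)·cellVisc(m+1)/√c⌋₊`, a diverging factor above the datum cut `Lc = ⌊ρ^{1/64}·…⌋₊` of `…TrimLevel` (finding F-lead-8), and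
charges everything above `Lg` as a leftover.  This file records the elementary facts the assembly uses about `Lg`:
* `Lc_le_Lg` — the datum cut lies below the leftover cut;
* `xfrac_le_of_norm_le_Lg` — on the tracked range the corrector fraction `x_ℓ = c|ℓ|²/(N² ν²)` is `≤ ρ^{1/48}`;
* `Lg_mul_ceil_le_N` — for `m ≥ m⋆` the tracked range lies inside the validity range of the slow-vector clause (V): `Lg·⌈K/ν⌉ ≤ N(m+1)`;
* `band_ratio_at_Lg_le` — the (V) rate-error driver at the top of the tracked range: `Lg·⌈K/ν⌉/N(m+1) ≤ ρ^{1/96}·(K + nu0)/√c` (`m ≥ 1`).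
Pure parameter bookkeeping from `Permissible` (+ k3l's `…TemplateAsymptotics`).  Infrastructure for rung F-D1.A0; NOT a proof of the crux or of AD.
-/

set_option linter.dupNamespace false

namespace Summit.AnomalousDissipation.AnomalousDissipation.Theorems.SolenoidalFractalHomogenisation.LagrangianStep

open Literature.Analysis Literature.Analysis.FluidPDE Literature.Analysis.FluidPDE.LatticeShear
open Summit.AnomalousDissipation.AnomalousDissipation.Theorems.SolenoidalFractalHomogenisation.LagrangianRenormalisationStep (cellVisc_pos')

variable {k : ℕ}

/-- `Lc ≤ Lg`: `ρ^{1/64} ≤ ρ^{1/96}` for `0 < ρ ≤ 1`, and floors are monotone. -/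
theorem Lc_le_Lg (D : FractalCarrierData k) (hP : D.Permissible) (m : ℕ) {c : ℝ} (hc : 0 < c) :
    ⌊((D.N m : ℝ) / D.N (m + 1)) ^ (1 / 64 : ℝ) * ((D.N (m + 1) : ℝ) * D.cellVisc (m + 1)) / Real.sqrt c⌋₊
      ≤ ⌊((D.N m : ℝ) / D.N (m + 1)) ^ (1 / 96 : ℝ) * ((D.N (m + 1) : ℝ) * D.cellVisc (m + 1)) / Real.sqrt c⌋₊ := by
  refine Nat.floor_le_floor ?_
  have hρ0 : 0 < (D.N m : ℝ) / D.N (m + 1) := by have := D.N_pos m; have := D.N_pos (m + 1); positivity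
  have hρ1 : (D.N m : ℝ) / D.N (m + 1) ≤ 1 := by
    have hN1 : (0 : ℝ) < D.N (m + 1) := by exact_mod_cast D.N_pos (m + 1)
    have h2 : (2 : ℝ) * D.N m ≤ D.N (m + 1) := by exact_mod_cast hP.2.2.1 m
    have h0 : (0 : ℝ) ≤ D.N m := by exact_mod_cast (D.N_pos m).le
    rw [div_le_one hN1]; linarith
  have hpow : ((D.N m : ℝ) / D.N (m + 1)) ^ (1 / 64 : ℝ) ≤ ((D.N m : ℝ) / D.N (m + 1)) ^ (1 / 96 : ℝ) :=
    Real.rpow_le_rpow_of_exponent_ge hρ0 hρ1 (by norm_num)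
  have hν := cellVisc_pos' D (m + 1)
  have : 0 ≤ ((D.N (m + 1) : ℝ) * D.cellVisc (m + 1)) / Real.sqrt c := by positivity
  calc ((D.N m : ℝ) / D.N (m + 1)) ^ (1 / 64 : ℝ) * ((D.N (m + 1) : ℝ) * D.cellVisc (m + 1)) / Real.sqrt c
      = ((D.N m : ℝ) / D.N (m + 1)) ^ (1 / 64 : ℝ) * (((D.N (m + 1) : ℝ) * D.cellVisc (m + 1)) / Real.sqrt c) := by ring
    _ ≤ ((D.N m : ℝ) / D.N (m + 1)) ^ (1 / 96 : ℝ) * (((D.N (m + 1) : ℝ) * D.cellVisc (m + 1)) / Real.sqrt c) :=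
        mul_le_mul_of_nonneg_right hpow this
    _ = _ := by ring

/-- **On the tracked range the corrector fraction is small**: if `|ℓ| ≤ Lg` then `c|ℓ|²/(N(m+1)² ν²) ≤ ρ^{1/48}` (`ν = cellVisc (m+1)`). -/
theorem xfrac_le_of_norm_le_Lg (D : FractalCarrierData k) (m : ℕ) {c : ℝ} (hc : 0 < c) {L : ℝ} (hL0 : 0 ≤ L)
    (hL : L ≤ ((D.N m : ℝ) / D.N (m + 1)) ^ (1 / 96 : ℝ) * ((D.N (m + 1) : ℝ) * D.cellVisc (m + 1)) / Real.sqrt c) :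
    c * L ^ 2 / ((D.N (m + 1) : ℝ) ^ 2 * D.cellVisc (m + 1) ^ 2) ≤ ((D.N m : ℝ) / D.N (m + 1)) ^ (1 / 48 : ℝ) := by
  have hν := cellVisc_pos' D (m + 1)
  have hN : (0 : ℝ) < D.N (m + 1) := by exact_mod_cast D.N_pos (m + 1)
  have hρ0 : 0 ≤ (D.N m : ℝ) / D.N (m + 1) := by have := D.N_pos m; positivity
  have hsc : 0 < Real.sqrt c := Real.sqrt_pos.2 hc
  set Y : ℝ := ((D.N m : ℝ) / D.N (m + 1)) ^ (1 / 96 : ℝ) * ((D.N (m + 1) : ℝ) * D.cellVisc (m + 1)) / Real.sqrt c with hY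
  have hY0 : 0 ≤ Y := by positivity
  have hL2 : L ^ 2 ≤ Y ^ 2 := pow_le_pow_left₀ hL0 hL 2
  have hY2 : c * Y ^ 2 = ((D.N m : ℝ) / D.N (m + 1)) ^ (1 / 48 : ℝ) * ((D.N (m + 1) : ℝ) ^ 2 * D.cellVisc (m + 1) ^ 2) := by
    rw [hY, div_pow, mul_pow, mul_pow, Real.sq_sqrt hc.le, ← Real.rpow_natCast (((D.N m : ℝ) / D.N (m + 1)) ^ (1 / 96 : ℝ)) 2,
      ← Real.rpow_mul hρ0]
    norm_num
    field_simp
  rw [div_le_iff₀ (by positivity)]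
  calc c * L ^ 2 ≤ c * Y ^ 2 := mul_le_mul_of_nonneg_left hL2 hc.le
    _ = _ := hY2

/-- The (V) rate-error driver at the top of the tracked range: `Lg·⌈K/ν⌉ / N(m+1) ≤ ρ^{1/96}·(K + nu0)/√c` for `m+1 ≥ 1`
(`⌈K/ν⌉ ≤ K/ν + 1`, `ν = cellVisc (m+1) < nu0` by `Permissible`). -/
theorem band_ratio_at_Lg_le (D : FractalCarrierData k) (hP : D.Permissible) (m : ℕ) {c : ℝ} (hc : 0 < c) :
    (⌊((D.N m : ℝ) / D.N (m + 1)) ^ (1 / 96 : ℝ) * ((D.N (m + 1) : ℝ) * D.cellVisc (m + 1)) / Real.sqrt c⌋₊ : ℝ)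
        * (⌈D.K / D.cellVisc (m + 1)⌉₊ : ℝ) / D.N (m + 1)
      ≤ ((D.N m : ℝ) / D.N (m + 1)) ^ (1 / 96 : ℝ) * (D.K + D.nu0) / Real.sqrt c := by
  have hν := cellVisc_pos' D (m + 1)
  have hνnu : D.cellVisc (m + 1) ≤ D.nu0 := (hP.2.2.2.2.1 (m + 1) (by omega)).le
  have hN : (0 : ℝ) < D.N (m + 1) := by exact_mod_cast D.N_pos (m + 1)
  have hK : 0 < D.K := D.K_pos
  have hρ0 : 0 ≤ ((D.N m : ℝ) / D.N (m + 1)) ^ (1 / 96 : ℝ) := Real.rpow_nonneg (by have := D.N_pos m; positivity) _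
  have hsc : 0 < Real.sqrt c := Real.sqrt_pos.2 hc
  set Y : ℝ := ((D.N m : ℝ) / D.N (m + 1)) ^ (1 / 96 : ℝ) * ((D.N (m + 1) : ℝ) * D.cellVisc (m + 1)) / Real.sqrt c with hY
  have hY0 : 0 ≤ Y := by positivity
  have hfloor : (⌊Y⌋₊ : ℝ) ≤ Y := Nat.floor_le hY0
  have hceil : (⌈D.K / D.cellVisc (m + 1)⌉₊ : ℝ) ≤ D.K / D.cellVisc (m + 1) + 1 :=
    (Nat.ceil_lt_add_one (div_nonneg hK.le hν.le)).le
  have hceil0 : 0 ≤ (⌈D.K / D.cellVisc (m + 1)⌉₊ : ℝ) := Nat.cast_nonneg _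
  -- `Y · (K/ν + 1) / N = ρ^{1/96} (K + ν)/√c ≤ ρ^{1/96} (K + nu0)/√c`
  have hmain : Y * (D.K / D.cellVisc (m + 1) + 1) / D.N (m + 1) = ((D.N m : ℝ) / D.N (m + 1)) ^ (1 / 96 : ℝ) * (D.K + D.cellVisc (m + 1)) / Real.sqrt c := by
    rw [hY]; field_simp
  calc (⌊Y⌋₊ : ℝ) * (⌈D.K / D.cellVisc (m + 1)⌉₊ : ℝ) / D.N (m + 1)
      ≤ Y * (D.K / D.cellVisc (m + 1) + 1) / D.N (m + 1) := by
        refine div_le_div_of_nonneg_right ?_ hN.le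
        exact mul_le_mul hfloor hceil hceil0 hY0
    _ = ((D.N m : ℝ) / D.N (m + 1)) ^ (1 / 96 : ℝ) * (D.K + D.cellVisc (m + 1)) / Real.sqrt c := hmain
    _ ≤ ((D.N m : ℝ) / D.N (m + 1)) ^ (1 / 96 : ℝ) * (D.K + D.nu0) / Real.sqrt c := by
        refine div_le_div_of_nonneg_right ?_ hsc.le
        exact mul_le_mul_of_nonneg_left (by linarith) hρ0

/-- **The tracked range lies inside (V)'s validity range, eventually**: there is `m⋆` with `Lg·⌈K/ν⌉ ≤ N(m+1)` for all `m ≥ m⋆`. -/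
theorem Lg_mul_ceil_le_N (D : FractalCarrierData k) (hP : D.Permissible) (hT1 : ∀ m, D.N m ^ 2 ≤ D.N (m + 1)) {c : ℝ} (hc : 0 < c) :
    ∃ mstar : ℕ, ∀ m, mstar ≤ m →
      (⌊((D.N m : ℝ) / D.N (m + 1)) ^ (1 / 96 : ℝ) * ((D.N (m + 1) : ℝ) * D.cellVisc (m + 1)) / Real.sqrt c⌋₊ : ℝ)
        * (⌈D.K / D.cellVisc (m + 1)⌉₊ : ℝ) ≤ D.N (m + 1) := by
  obtain ⟨mstar, hm⟩ := exists_forall_mul_rho_rpow_le D hP hT1 ((D.K + D.nu0) / Real.sqrt c) (σ := 1 / 96) (by norm_num) one_pos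
  refine ⟨mstar, fun m hmm => ?_⟩
  have hN : (0 : ℝ) < D.N (m + 1) := by exact_mod_cast D.N_pos (m + 1)
  have h1 := band_ratio_at_Lg_le D hP m hc
  have h2 : ((D.N m : ℝ) / D.N (m + 1)) ^ (1 / 96 : ℝ) * (D.K + D.nu0) / Real.sqrt c ≤ 1 := by
    have := hm m hmm
    calc ((D.N m : ℝ) / D.N (m + 1)) ^ (1 / 96 : ℝ) * (D.K + D.nu0) / Real.sqrt c
        = (D.K + D.nu0) / Real.sqrt c * ((D.N m : ℝ) / D.N (m + 1)) ^ (1 / 96 : ℝ) := by ring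
      _ ≤ 1 := this
  have h3 := (div_le_iff₀ hN).1 (h1.trans h2)
  linarith

end Summit.AnomalousDissipation.AnomalousDissipation.Theorems.SolenoidalFractalHomogenisation.LagrangianStep
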